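import Literature.Analysis.FluidPDE.LerayHopfRestartForced
import Literature.Analysis.FluidPDE.TaoH1AlmostRegularForced
import Literature.Analysis.FluidPDE.TaoForcedBoundedTotalSpeed
import Literature.Analysis.FluidPDE.ClayForceTimeShift
import Literature.Analysis.FluidPDE.SerrinEnstrophyGronwallForced
import HarnessLib

/-!
# Leray's continuation of `H¹`-regularity for FORCED Leray–Hopf solutions (Clay-class force),
# from Tao's forced local `H¹` theory

Analysis/FluidPDE proof file (no definitions, no named facts) — the forced twin of the accepted
continuation chain `LerayH1Continuation.lean` / `NSSerrinRegularityTao.lean` (unforced system):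

* `isH1RegularOn_Icc_of_good_time_abstract`, `isH1RegularOn_Ioc_of_good_times_abstract` — the
  accepted continuation argument (Robinson–Rodrigo–Sadowski 2016, §8.1, Lemma 8.4 and proof of
  Thm. 8.14) with BOTH the local theory and the notion of a good restarting time abstracted into
  hypotheses (a one-step lemma with a lifespan `τ(A) > 0` attached to an `H¹` bound `A`, and a
  dense set of good times), so that it serves the unforced and the forced system alike;
* `clayForce_exists_eH1NormSq_le`, `clayForce_lintegral_sqrt_eH1NormSq_translate_le` — a
  Clay-class force (`IsSmoothOnHalfSpace`, `HasRapidSpaceTimeDecay`: Fefferman (5)–(6)) is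
  `L^∞_t H¹_x`, hence `‖f(· + s)‖_{L¹_t H¹_x([0,T])} ≤ B_T` uniformly in the shift `s ≥ 0` (the force
  budget in the smallness condition `(√A + B)⁴ T ≤ c ν³` of Tao 2013, Thm. 5.4 (ii) with force, as
  rendered by the tree's named fact `TaoForcedH1AlmostRegularWith c`);
* `isH1RegularOn_Icc_step_tao_forced` — ONE continuation step for a forced Leray–Hopf solution
  from a good restarting time `s` (`u(· + s)` Leray–Hopf with force `f(· + s)` from `u(s)`, true for
  a.e. `s` by `IsLerayHopfOn.ae_isLerayHopfOn_restart_forced`), given Tao's forced local theory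
  `TaoForcedH1AlmostRegularWith c`: the local solution from `u(s)` is `H¹`-continuous and lies in
  `L^∞_t L⁶_x`, so it coincides with `u(· + s)` by the PROVED forced Serrin–Masuda weak–strong
  uniqueness theorem `serrinMasuda_weak_strong_uniqueness_forced` (Sohr 2001, Thm. V.1.5.1);
* `isH1RegularOn_Icc_of_good_time_forced`, `isH1RegularOn_Ioc_forced_of_tao` — Leray's
  continuation theorem for the forced system: if the `H¹` norm of a forced Leray–Hopf solution
  (Clay-class force) stays bounded to the left of the right end of every `H¹`-regular interval,
  the solution is `H¹`-regular on `(0, T]` (Cheskidov–Shvydkoy 2010, Thm. 2.4 (`s = 1`), forced),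
  CONDITIONALLY on the named fact `tao2011_forced_H1_local_almost_regular`
  (`TaoH1AlmostRegularForced.lean`) — exactly as the unforced tree theorem
  `leray_continuation_H1_of_tao` is conditional on (the now discharged)
  `tao2011_H1_local_almost_regular`.

The Serrin-class application (forced Ladyzhenskaya–Prodi–Serrin / Sohr's Thm. V.1.8.1 for
Clay-class forces) is the sequel file `NSSerrinRegularityForced.lean`.

## References

* J. C. Robinson, J. L. Rodrigo, W. Sadowski, *The Three-Dimensional Navier–Stokes Equations*,
  CUP 2016: Lemma 6.11, §8.1 with Lemma 8.4, Thm. 8.14. [RobinsonRodrigoSadowski2016]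
* T. Tao, Anal. PDE 6 (2013) = arXiv:1108.1165, Thm. 5.4 (= arXiv Thm. 31), §1 p. 3. [Tao2011]
* A. Cheskidov, R. Shvydkoy, ARMA 195 (2010), Thm. 2.4. [CheskidovShvydkoy2010]
* H. Sohr, *The Navier–Stokes Equations*, Birkhäuser 2001, Ch. V, Thm. 1.5.1, Thm. 1.8.1. [Sohr2001]
* C. Fefferman, Clay problem description (2006), (5)–(6). [FeffermanClay2006]
-/

noncomputable section

open MeasureTheory TopologicalSpace Set Function Filter Topology InnerProductSpace Metric
open scoped RealInnerProductSpace ENNReal NNReal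

namespace Literature.Analysis.FluidPDE

/-! ### The interval of regularity issued from a good time reaches `T` (abstract restart form) -/

section Continuation

variable {u : ℝ → EuclideanSpace ℝ (Fin 3) → EuclideanSpace ℝ (Fin 3)} {T : ℝ}

/-- **The interval of regularity issued from a good time reaches `T` — abstract restart form**
(Robinson–Rodrigo–Sadowski 2016, §8.1, Lemma 8.4 and proof of Thm. 8.14, p. 128). The accepted
`isH1RegularOn_Icc_of_good_time_of_step` (`NSSerrinRegularityTao.lean`) with the local theory AND
the notion of a good restarting time abstracted: `Good s` is any property of times that holds
somewhere in every subinterval of `(0, T)` (`hdense`; for Leray–Hopf solutions: "the energy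
inequality holds from `s`", true a.e.), and the one-step lemma `hstep` says that from a good time
`s` with `‖u(s)‖²_{H¹} ≤ A` the trajectory is `H¹`-regular on `[s, min(s + τ(A), T)]` for a lifespan
`τ(A) > 0` depending only on the bound (for the forced system `τ` also depends on the force, fixed).
If moreover the `H¹` norm stays bounded to the left of the right end of every `H¹`-regular open
interval (`hhyp`), then from every good time `s` with `‖u(s)‖_{H¹} < ∞` the trajectory is
`H¹`-regular on `[s, T]`: the supremum `β` of the right ends `b` with `u` regular on `[s, b]` is
`T`, since a restart at a good time just below `β` with the lifespan attached to the `limsup` bound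
carries regularity past `β`. Statement and proof otherwise verbatim from the accepted lemma.
[cite: RobinsonRodrigoSadowski2016, Thm. 8.14 (proof) and Lemma 8.4] -/
theorem isH1RegularOn_Icc_of_good_time_abstract {Good : ℝ → Prop} {τ : ℝ → ℝ}
    (hτ : ∀ A : ℝ, 0 ≤ A → 0 < τ A)
    (hstep : ∀ ⦃s : ℝ⦄, s ∈ Ioo 0 T → Good s → ∀ ⦃A : ℝ⦄, 0 ≤ A →
      eH1NormSq (u s) ≤ ENNReal.ofReal A → IsH1RegularOn (Icc s (min (s + τ A) T)) u)
    (hdense : ∀ ⦃a b : ℝ⦄, 0 ≤ a → a < b → b ≤ T → ∃ s ∈ Ioo a b, Good s)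
    (hhyp : ∀ α β : ℝ, 0 ≤ α → α < β → β ≤ T → IsH1RegularOn (Ioo α β) u →
      limsup (fun t => eH1NormSq (u t)) (𝓝[<] β) < ∞)
    {s : ℝ} (hs : s ∈ Ioo 0 T) (hgs : Good s) (hfin : eH1NormSq (u s) < ∞) :
    IsH1RegularOn (Icc s T) u := by
  -- first step from `s`
  set A : ℝ := (eH1NormSq (u s)).toReal with hAdef
  have hA : 0 ≤ A := ENNReal.toReal_nonneg
  have hAs : eH1NormSq (u s) ≤ ENNReal.ofReal A := (ENNReal.ofReal_toReal hfin.ne).ge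
  have hτ0 : 0 < τ A := hτ A hA
  have h0 : IsH1RegularOn (Icc s (min (s + τ A) T)) u := hstep hs hgs hA hAs
  -- the candidate right ends
  set B : Set ℝ := {b | s < b ∧ b ≤ T ∧ IsH1RegularOn (Icc s b) u} with hBdef
  have hsb₀ : s < min (s + τ A) T := lt_min (by linarith) hs.2
  have hb₀ : min (s + τ A) T ∈ B := ⟨hsb₀, min_le_right _ _, h0⟩
  have hBne : B.Nonempty := ⟨_, hb₀⟩
  have hBbdd : BddAbove B := ⟨T, fun b hb => hb.2.1⟩
  set β : ℝ := sSup B with hβdef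
  have hβT : β ≤ T := csSup_le hBne fun b hb => hb.2.1
  have hsβ : s < β := hsb₀.trans_le (le_csSup hBbdd hb₀)
  -- `u` is `H¹`-regular on `[s, β)`
  have hIco : IsH1RegularOn (Ico s β) u := by
    refine ⟨fun t ht => ?_, fun t ht => ?_⟩
    · obtain ⟨b, hb, htb⟩ := exists_lt_of_lt_csSup hBne ht.2
      exact hb.2.2.1 t ⟨ht.1, htb.le⟩
    · obtain ⟨b, hb, htb⟩ := exists_lt_of_lt_csSup hBne ht.2
      have h1 : ContinuousWithinAt (fun t => eH1NormSq (u t)) (Icc s b) t :=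
        hb.2.2.2 t ⟨ht.1, htb.le⟩
      refine h1.mono_of_mem_nhdsWithin (mem_nhdsWithin.2 ⟨Iio b, isOpen_Iio, htb, ?_⟩)
      rintro x ⟨hxb, hx⟩
      exact ⟨hx.1, le_of_lt hxb⟩
  -- the `H¹` norm is bounded on a left neighbourhood of `β`
  have hlim := hhyp s β hs.1.le hsβ hβT (hIco.mono Ioo_subset_Ico_self)
  set L : ℝ≥0∞ := limsup (fun t => eH1NormSq (u t)) (𝓝[<] β) with hLdef
  have hL1 : L + 1 < ∞ := ENNReal.add_lt_top.2 ⟨hlim, ENNReal.one_lt_top⟩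
  have hev : ∀ᶠ t in 𝓝[<] β, eH1NormSq (u t) < L + 1 :=
    eventually_lt_of_limsup_lt (ENNReal.lt_add_right hlim.ne one_ne_zero)
  obtain ⟨l, hl, hlsub⟩ := mem_nhdsLT_iff_exists_Ioo_subset.1 hev
  set A₁ : ℝ := (L + 1).toReal with hA₁def
  have hA₁ : 0 ≤ A₁ := ENNReal.toReal_nonneg
  set τ₁ : ℝ := τ A₁ with hτ₁def
  have hτ₁ : 0 < τ₁ := hτ A₁ hA₁
  -- a good restarting time `s₁ ∈ (max (max l s) (β - τ₁), β)`
  set a₁ : ℝ := max (max l s) (β - τ₁) with ha₁def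
  have ha₁β : a₁ < β := max_lt (max_lt hl hsβ) (by linarith)
  have ha₁0 : 0 ≤ a₁ := hs.1.le.trans ((le_max_right _ _).trans (le_max_left _ _))
  obtain ⟨s₁, hs₁, hgs₁⟩ := hdense ha₁0 ha₁β hβT
  have hls₁ : l < s₁ := ((le_max_left _ _).trans (le_max_left _ _)).trans_lt hs₁.1
  have hss₁ : s < s₁ := ((le_max_right _ _).trans (le_max_left _ _)).trans_lt hs₁.1
  have hβs₁ : β - τ₁ < s₁ := (le_max_right _ _).trans_lt hs₁.1
  have hs₁T : s₁ ∈ Ioo 0 T := ⟨hs.1.trans hss₁, hs₁.2.trans_le hβT⟩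
  have hAs₁ : eH1NormSq (u s₁) ≤ ENNReal.ofReal A₁ := by
    have h1 : eH1NormSq (u s₁) < L + 1 := hlsub ⟨hls₁, hs₁.2⟩
    rw [hA₁def, ENNReal.ofReal_toReal hL1.ne]
    exact h1.le
  have hstep₁ : IsH1RegularOn (Icc s₁ (min (s₁ + τ₁) T)) u := hstep hs₁T hgs₁ hA₁ hAs₁
  -- paste with a regular `[s, b]`, `b > s₁`
  obtain ⟨b, hb, hs₁b⟩ := exists_lt_of_lt_csSup hBne hs₁.2
  have hb' : IsH1RegularOn (Icc s (min (s₁ + τ₁) T)) u := by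
    refine (hb.2.2.union_Icc hstep₁).mono fun x hx => ?_
    by_cases hxb : x ≤ b
    · exact Or.inl ⟨hx.1, hxb⟩
    · exact Or.inr ⟨(hs₁b.trans (lt_of_not_ge hxb)).le, hx.2⟩
  have hmem : min (s₁ + τ₁) T ∈ B := ⟨lt_min (by linarith) hs.2, min_le_right _ _, hb'⟩
  have hle : min (s₁ + τ₁) T ≤ β := le_csSup hBbdd hmem
  by_cases hcase : s₁ + τ₁ ≤ T
  · exfalso
    rw [min_eq_left hcase] at hle
    linarith
  · push Not at hcase
    rw [min_eq_right hcase.le] at hb'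
    exact hb'

/-- **Every positive time has a regular closed interval from a good time to its left**, hence the
trajectory is `H¹`-regular on `(0, T]` — the conclusion of Leray's continuation theorem
(Cheskidov–Shvydkoy 2010, Thm. 2.4, `s = 1`) in the abstract restart form: good times with finite
`H¹` norm occur in every initial layer (`hgood`), from each of them the interval of regularity
reaches `T` (`isH1RegularOn_Icc_of_good_time_abstract`; good times with finite norm are in
particular good, so they are dense as required there). [cite: CheskidovShvydkoy2010, Thm. 2.4 (case s = 1)] -/
theorem isH1RegularOn_Ioc_of_good_times_abstract {Good : ℝ → Prop} {τ : ℝ → ℝ}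
    (hτ : ∀ A : ℝ, 0 ≤ A → 0 < τ A)
    (hstep : ∀ ⦃s : ℝ⦄, s ∈ Ioo 0 T → Good s → ∀ ⦃A : ℝ⦄, 0 ≤ A →
      eH1NormSq (u s) ≤ ENNReal.ofReal A → IsH1RegularOn (Icc s (min (s + τ A) T)) u)
    (hgood : ∀ ⦃a b : ℝ⦄, 0 ≤ a → a < b → b ≤ T → ∃ s ∈ Ioo a b, Good s ∧ eH1NormSq (u s) < ∞)
    (hhyp : ∀ α β : ℝ, 0 ≤ α → α < β → β ≤ T → IsH1RegularOn (Ioo α β) u →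
      limsup (fun t => eH1NormSq (u t)) (𝓝[<] β) < ∞) :
    IsH1RegularOn (Ioc 0 T) u := by
  have hdense : ∀ ⦃a b : ℝ⦄, 0 ≤ a → a < b → b ≤ T → ∃ s ∈ Ioo a b, Good s :=
    fun a b ha hab hb => (hgood ha hab hb).imp fun s hs => ⟨hs.1, hs.2.1⟩
  have hloc' : ∀ t ∈ Ioc 0 T, ∃ s ∈ Ioo 0 t, IsH1RegularOn (Icc s T) u := by
    intro t ht
    obtain ⟨s, hs, hgs, hfs⟩ := hgood le_rfl ht.1 ht.2
    exact ⟨s, hs, isH1RegularOn_Icc_of_good_time_abstract hτ hstep hdense hhyp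
      ⟨hs.1, hs.2.trans_le ht.2⟩ hgs hfs⟩
  refine ⟨fun t ht => ?_, fun t ht => ?_⟩
  · obtain ⟨s, hs, hreg⟩ := hloc' t ht
    exact hreg.1 t ⟨hs.2.le, ht.2⟩
  · obtain ⟨s, hs, hreg⟩ := hloc' t ht
    refine (hreg.2 t ⟨hs.2.le, ht.2⟩).mono_of_mem_nhdsWithin
      (mem_nhdsWithin.2 ⟨Ioi s, isOpen_Ioi, hs.2, ?_⟩)
    rintro x ⟨hxs, hx⟩
    exact ⟨le_of_lt hxs, hx.2⟩

end Continuation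
/-! ### The `L¹_t H¹_x` budget of a Clay-class force -/

section ClayBudget

variable {f : ℝ → EuclideanSpace ℝ (Fin 3) → EuclideanSpace ℝ (Fin 3)}

/-- **A Clay-class force is `L^∞_t H¹_x`** (Tao 2011, §1, p. 3: Schwartz forcing is in every
`L^∞_t H^k_x`; Fefferman's class (5)–(6)): there is `M < ∞` with `‖f(t)‖²_{H¹} ≤ M` for all
`t ≥ 0`, the `H¹` norm being the tree's `eH1NormSq = ∫⁻‖·‖ₑ² + eWeakGradL2Sq` (the classical
gradient of the smooth slice is a weak gradient; Frobenius vs operator norm costs a factor `3`).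
[cite: Tao2011, §1 p. 3] -/
theorem clayForce_exists_eH1NormSq_le (hfs : IsSmoothOnHalfSpace f) (hfd : HasRapidSpaceTimeDecay f) :
    ∃ M : ℝ≥0, ∀ t, 0 ≤ t → eH1NormSq (f t) ≤ M := by
  obtain ⟨C₀, hC₀⟩ := hfd.exists_lintegral_iteratedFDeriv_slice_sq_le (μ := volume) hfs 0 zero_le_one
  obtain ⟨C₁, hC₁⟩ := hfd.exists_lintegral_iteratedFDeriv_slice_sq_le (μ := volume) hfs 1 le_rfl
  refine ⟨C₀ + 3 * C₁, fun t ht => ?_⟩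
  have hsm : ContDiff ℝ (⊤ : ℕ∞) (f t) := (hfs.isSmoothSpaceTimeOn_Icc t).contDiff_slice ⟨ht, le_rfl⟩
  have hWG : HasWeakGradient (f t) (fderiv ℝ (f t)) :=
    hasWeakGradient_fderiv_of_contDiff (hsm.of_le (by exact_mod_cast le_top))
  refine (eH1NormSq_le_of_hasWeakGradient hWG).trans ?_
  push_cast
  refine add_le_add ?_ ?_
  · -- `∫⁻ ‖f t‖ₑ² ≤ C₀`
    refine le_trans (le_of_eq (lintegral_congr fun x => ?_)) (hC₀ t ht)
    rw [← ofReal_norm, ← ofReal_norm, norm_iteratedFDeriv_zero]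
  · -- `∫⁻ |D f t|² ≤ 3 ∫⁻ ‖D f t‖ₑ² ≤ 3 C₁`
    calc ∫⁻ x, ENNReal.ofReal (frobeniusNormSq (fderiv ℝ (f t) x))
        ≤ ∫⁻ x, 3 * ‖iteratedFDeriv ℝ 1 (f t) x‖ₑ ^ 2 := by
          refine lintegral_mono fun x => ?_
          have h3 : frobeniusNormSq (fderiv ℝ (f t) x) ≤ 3 * ‖iteratedFDeriv ℝ 1 (f t) x‖ ^ 2 := by
            rw [norm_iteratedFDeriv_one]; exact frobeniusNormSq_le_three_mul _
          calc ENNReal.ofReal (frobeniusNormSq (fderiv ℝ (f t) x))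
              ≤ ENNReal.ofReal (3 * ‖iteratedFDeriv ℝ 1 (f t) x‖ ^ 2) := ENNReal.ofReal_le_ofReal h3
            _ = 3 * ‖iteratedFDeriv ℝ 1 (f t) x‖ₑ ^ 2 := by
                rw [ENNReal.ofReal_mul (by norm_num : (0 : ℝ) ≤ 3), ENNReal.ofReal_pow (norm_nonneg _),
                  ofReal_norm, ENNReal.ofReal_ofNat]
      _ = 3 * ∫⁻ x, ‖iteratedFDeriv ℝ 1 (f t) x‖ₑ ^ 2 := by
          rw [lintegral_const_mul' _ _ (by norm_num)]
      _ ≤ 3 * C₁ := by gcongr; exact hC₁ t ht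

/-- **The `L¹_t H¹_x` budget of a Clay-class force, uniformly over forward time shifts**: for
every `T` there is `B ≥ 0` with `∫₀^{T'} ‖f(t + s)‖_{H¹} dt ≤ B` for all `s ≥ 0` and `T' ≤ T`
(`‖f(t)‖²_{H¹} ≤ M` for `t ≥ 0`, so the integral is at most `√M · T`). This is the force term of
the smallness hypothesis `(√A + B)⁴ T ≤ c ν³` of Tao 2013, Thm. 5.4 (ii) with force (tree rendering
`TaoForcedH1AlmostRegularWith`), made uniform in the restarting time. [cite: Tao2011, Thm. 5.4 (ii) (with §1 p. 3)] -/
theorem clayForce_lintegral_sqrt_eH1NormSq_translate_le (hfs : IsSmoothOnHalfSpace f)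
    (hfd : HasRapidSpaceTimeDecay f) (T : ℝ) :
    ∃ B : ℝ, 0 ≤ B ∧ ∀ s, 0 ≤ s → ∀ T', T' ≤ T →
      ∫⁻ t in Ioo 0 T', eH1NormSq (f (t + s)) ^ (2⁻¹ : ℝ) ≤ ENNReal.ofReal B := by
  obtain ⟨M, hM⟩ := clayForce_exists_eH1NormSq_le hfs hfd
  set I : ℝ≥0∞ := (M : ℝ≥0∞) ^ (2⁻¹ : ℝ) * ENNReal.ofReal T with hI
  have hItop : I ≠ ⊤ :=
    ENNReal.mul_ne_top (ENNReal.rpow_ne_top_of_nonneg (by norm_num) ENNReal.coe_ne_top)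
      ENNReal.ofReal_ne_top
  refine ⟨I.toReal, ENNReal.toReal_nonneg, fun s hs T' hT' => ?_⟩
  rw [ENNReal.ofReal_toReal hItop]
  calc ∫⁻ t in Ioo 0 T', eH1NormSq (f (t + s)) ^ (2⁻¹ : ℝ)
      ≤ ∫⁻ _ in Ioo 0 T', (M : ℝ≥0∞) ^ (2⁻¹ : ℝ) := by
        refine setLIntegral_mono' measurableSet_Ioo fun t ht => ?_
        exact ENNReal.rpow_le_rpow (hM (t + s) (by linarith [ht.1])) (by norm_num)
    _ = (M : ℝ≥0∞) ^ (2⁻¹ : ℝ) * volume (Ioo (0 : ℝ) T') := setLIntegral_const _ _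
    _ ≤ I := by
        rw [hI, Real.volume_Ioo]
        gcongr
        linarith

end ClayBudget

/-! ### One continuation step from Tao's forced local `H¹` theory -/

section Step

variable {ν T : ℝ} {f : ℝ → EuclideanSpace ℝ (Fin 3) → EuclideanSpace ℝ (Fin 3)}
  {u₀ : EuclideanSpace ℝ (Fin 3) → EuclideanSpace ℝ (Fin 3)}
  {u : ℝ → EuclideanSpace ℝ (Fin 3) → EuclideanSpace ℝ (Fin 3)}

/-- **One continuation step from Tao's FORCED local `H¹` theory** (Robinson–Rodrigo–Sadowski
2016, proof of Lemma 6.11: "we can construct a strong solution `v` with initial condition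
`v(0) = u(t)` […]. Using weak–strong uniqueness `u(t+s) = v(s)`", forced form; Sohr 2001, Ch. V,
proof of Thm. 1.8.1: restart of the forced weak solution at an intermediate time). Let `u` be a
Leray–Hopf weak solution on `ℝ³ × [0, T)` of the system forced by a Clay-class `f`, `s ∈ (0, T)` a
good restarting time (`u(· + s)` Leray–Hopf with force `f(· + s)` from `u(s)`),
`‖u(s)‖²_{H¹} ≤ A`, `∫₀^{τ'} ‖f(t + s)‖_{H¹} dt ≤ B` on `τ' = min τ (T - s)`, and
`(√A + B)⁴ τ ≤ c ν³`. Given `TaoForcedH1AlmostRegularWith c`, `‖u(t)‖²_{H¹}` is finite and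
continuous on `[s, min(s + τ, T)]`: Tao's forced local solution `v` from `u(s)` with force
`f(· + s)` (a Clay-class force again, `IsSmoothOnHalfSpace.timeShift` /
`HasRapidSpaceTimeDecay.timeShift`) is `H¹`-continuous on `[0, τ']`, hence in the Serrin class
`L^∞_t L⁶_x`, so `u(t + s) = v(t)` a.e. by the proved forced Serrin–Masuda theorem
`serrinMasuda_weak_strong_uniqueness_forced` (its force class: `f(· + s)` is jointly measurable and
in `L²((0,τ') × ℝ³)`, `clayForce_prod_aestronglyMeasurable` / `clayForce_prod_eLpNorm_lt_top`),
and a.e.-equal slices have the same `H¹` norm. The forced twin of the accepted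
`isH1RegularOn_Icc_step_tao`, same proof. [cite: RobinsonRodrigoSadowski2016, Lemma 6.11 (proof)] -/
theorem isH1RegularOn_Icc_step_tao_forced {c : ℝ} (hloc : TaoForcedH1AlmostRegularWith c)
    (hν : 0 < ν) (hfs : IsSmoothOnHalfSpace f) (hfd : HasRapidSpaceTimeDecay f)
    (hLH : IsLerayHopfOn T ν f u₀ u) {s : ℝ} (hs : s ∈ Ioo 0 T)
    (hLHs : IsLerayHopfOn (T - s) ν (fun t => f (t + s)) (u s) (fun t => u (t + s)))
    {A B τ : ℝ} (hA : 0 ≤ A) (hB : 0 ≤ B) (hAs : eH1NormSq (u s) ≤ ENNReal.ofReal A)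
    (hτ : 0 < τ)
    (hBs : ∫⁻ t in Ioo 0 (min τ (T - s)), eH1NormSq (f (t + s)) ^ (2⁻¹ : ℝ) ≤ ENNReal.ofReal B)
    (hτc : (Real.sqrt A + B) ^ 4 * τ ≤ c * ν ^ 3) :
    IsH1RegularOn (Icc s (min (s + τ) T)) u := by
  set τ' : ℝ := min τ (T - s) with hτ'def
  have hτ' : 0 < τ' := lt_min hτ (sub_pos.2 hs.2)
  have hu2 : MemLp (u s) 2 volume := hLH.memLp s ⟨hs.1.le, hs.2.le⟩
  have hdiv : IsWeaklyDivFree (u s) := hLHs.isWeaklyDivFree_datum (sub_pos.2 hs.2)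
  have hfs' : IsSmoothOnHalfSpace (fun t => f (t + s)) := hfs.timeShift hs.1.le
  have hfd' : HasRapidSpaceTimeDecay (fun t => f (t + s)) := hfd.timeShift hfs hs.1.le
  have hτ'c : (Real.sqrt A + B) ^ 4 * τ' ≤ c * ν ^ 3 :=
    (mul_le_mul_of_nonneg_left (min_le_left _ _) (by positivity)).trans hτc
  obtain ⟨v, hv, hv0, hvreg⟩ :=
    hloc.exists_isH1RegularOn hν hτ' hu2 hdiv hfs' hfd' hA hB hAs hBs hτ'c
  -- forced weak–strong uniqueness: `u(t + s) = v(t)` a.e., `0 < t ≤ τ'`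
  have hLHs' : IsLerayHopfOn τ' ν (fun t => f (t + s)) (u s) (fun t => u (t + s)) :=
    hLHs.of_le (min_le_right _ _)
  have hS : MemLqLp ∞ 6 v (Ioo 0 τ') :=
    memLqLp_top_six_of_isH1RegularOn_Icc hvreg fun t ht => hv.memLp t ht
  have hqr : 2 / (∞ : ℝ≥0∞) + 3 / 6 ≤ 1 := by
    rw [ENNReal.div_top, zero_add]
    exact ENNReal.div_le_of_le_mul (by norm_num)
  have hfm' := clayForce_prod_aestronglyMeasurable (T := τ') hfs'
  have hf2' := clayForce_prod_eLpNorm_lt_top (T := τ') hfs' hfd'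
  have hae : ∀ t ∈ Ioc 0 τ', (fun t => u (t + s)) t =ᵐ[volume] v t :=
    serrinMasuda_weak_strong_uniqueness_forced hν hτ' hfm' hf2' hv hu2 (q := ∞) (r := 6)
      (by norm_num) hqr hS hLHs'
  -- the `H¹` norms of `u` on `[s, s + τ']` are those of `v` on `[0, τ']`
  have heq : ∀ t ∈ Icc s (s + τ'), eH1NormSq (u t) = eH1NormSq (v (t - s)) := by
    intro t ht
    rcases eq_or_lt_of_le ht.1 with h | h
    · rw [← h, sub_self, hv0]
    · have h1 := hae (t - s) ⟨sub_pos.2 h, by linarith [ht.2]⟩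
      simp only [sub_add_cancel] at h1
      exact eH1NormSq_congr_ae h1
  have hmin : min (s + τ) T = s + τ' := by
    rw [hτ'def, ← min_add_add_left, add_sub_cancel]
  have hmaps : MapsTo (fun t => t - s) (Icc s (s + τ')) (Icc 0 τ') := fun t ht =>
    ⟨sub_nonneg.2 ht.1, by linarith [ht.2]⟩
  rw [hmin]
  refine ⟨fun t ht => ?_, ?_⟩
  · rw [heq t ht]
    exact hvreg.1 (t - s) (hmaps ht)
  · have hc : ContinuousOn (fun t => eH1NormSq (v (t - s))) (Icc s (s + τ')) :=
      hvreg.2.comp (continuousOn_id.sub continuousOn_const) hmaps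
    exact hc.congr fun t ht => heq t ht

end Step

/-! ### Leray's continuation theorem for the forced system -/

section Forced

variable {ν T : ℝ} {f : ℝ → EuclideanSpace ℝ (Fin 3) → EuclideanSpace ℝ (Fin 3)}
  {u₀ : EuclideanSpace ℝ (Fin 3) → EuclideanSpace ℝ (Fin 3)}
  {u : ℝ → EuclideanSpace ℝ (Fin 3) → EuclideanSpace ℝ (Fin 3)}

/-- **The interval of regularity issued from a good time reaches `T` (forced system, Clay-class
force)** (Robinson–Rodrigo–Sadowski 2016, proof of Thm. 8.14 with Lemma 8.4; Sohr 2001, Ch. V,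
proof of Thm. 1.8.1, iteration after (1.8.20): "Since `C` in (1.8.16) does not depend on `T'`, we can
repeat this procedure … After finitely many steps"). Given Tao's forced local `H¹` theory with
constant `c > 0`: if the `H¹` norm of a Leray–Hopf solution of the forced system stays bounded to
the left of the right end of every `H¹`-regular open interval, then from every good restarting
time `s` with `‖u(s)‖_{H¹} < ∞` the solution is `H¹`-regular on `[s, T]`
(`isH1RegularOn_Icc_of_good_time_abstract` with the one-step lemma
`isH1RegularOn_Icc_step_tao_forced`, the lifespan `τ(A) = c ν³ / ((√A + B)⁴ + 1)` for the uniform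
force budget `B` of `clayForce_lintegral_sqrt_eH1NormSq_translate_le`, and the dense good times
of `IsLerayHopfOn.exists_isLerayHopfOn_restart_forced_Ioo`). [cite: RobinsonRodrigoSadowski2016, Thm. 8.14 (proof) and Lemma 8.4] -/
theorem isH1RegularOn_Icc_of_good_time_forced {c : ℝ} (hc : 0 < c)
    (hloc : TaoForcedH1AlmostRegularWith c) (hν : 0 < ν) (hfs : IsSmoothOnHalfSpace f)
    (hfd : HasRapidSpaceTimeDecay f) (hLH : IsLerayHopfOn T ν f u₀ u)
    (hhyp : ∀ α β : ℝ, 0 ≤ α → α < β → β ≤ T → IsH1RegularOn (Ioo α β) u →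
      limsup (fun t => eH1NormSq (u t)) (𝓝[<] β) < ∞)
    {s : ℝ} (hs : s ∈ Ioo 0 T)
    (hLHs : IsLerayHopfOn (T - s) ν (fun t => f (t + s)) (u s) (fun t => u (t + s)))
    (hfin : eH1NormSq (u s) < ∞) : IsH1RegularOn (Icc s T) u := by
  obtain ⟨B, hB, hBle⟩ := clayForce_lintegral_sqrt_eH1NormSq_translate_le hfs hfd T
  have hfm := clayForce_prod_aestronglyMeasurable (T := T) hfs
  have hf2 := clayForce_prod_eLpNorm_lt_top (T := T) hfs hfd
  -- lifespan attached to a bound `A` on the squared `H¹` norm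
  set τ : ℝ → ℝ := fun A => c * ν ^ 3 / ((Real.sqrt A + B) ^ 4 + 1) with hτdef
  have hτ : ∀ A : ℝ, 0 ≤ A → 0 < τ A := fun A _ => by positivity
  have hτc : ∀ A : ℝ, 0 ≤ A → (Real.sqrt A + B) ^ 4 * τ A ≤ c * ν ^ 3 := by
    intro A hA
    show (Real.sqrt A + B) ^ 4 * (c * ν ^ 3 / ((Real.sqrt A + B) ^ 4 + 1)) ≤ c * ν ^ 3
    rw [mul_div_assoc', div_le_iff₀ (by positivity)]
    nlinarith [pow_nonneg (add_nonneg (Real.sqrt_nonneg A) hB) 4, mul_pos hc (pow_pos hν 3)]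
  refine isH1RegularOn_Icc_of_good_time_abstract
    (Good := fun s => IsLerayHopfOn (T - s) ν (fun t => f (t + s)) (u s) (fun t => u (t + s)))
    hτ (fun s' hs' hgs' A hA hAs' => ?_) (fun a b ha hab hb => ?_) hhyp hs hLHs hfin
  · refine isH1RegularOn_Icc_step_tao_forced hloc hν hfs hfd hLH hs' hgs' hA hB hAs' (hτ A hA)
      ?_ (hτc A hA)
    exact hBle s' hs'.1.le _ ((min_le_right _ _).trans (by linarith [hs'.1]))
  · exact hLH.exists_isLerayHopfOn_restart_forced_Ioo hν.le hfm hf2 ha hab hb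

/-- **Leray's continuation theorem for the FORCED system (Cheskidov–Shvydkoy 2010, Thm. 2.4,
`s = 1`, forced; Clay-class force), from Tao's forced local `H¹` theory**: let `ν > 0` and let
`u` be a Leray–Hopf weak solution on `ℝ³ × [0, T)` of the Navier–Stokes system forced by a
Clay-class `f` whose `H¹` norm stays bounded to the left of the right end of every `H¹`-regular
open interval `(α, β) ⊆ (0, T)`. Then `u` is `H¹`-regular on `(0, T]`. Good restarting times
(energy inequality from `s`, `u(s) ∈ H¹`) have full measure
(`IsLerayHopfOn.ae_isLerayHopfOn_restart_forced`, `ae_eH1NormSq_lt_top`); from each of them the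
interval of regularity reaches `T` (`isH1RegularOn_Icc_of_good_time_forced`). CONDITIONAL on the
named fact `tao2011_forced_H1_local_almost_regular` (the unforced twin `leray_continuation_H1_of_tao`
is conditional on the discharged `tao2011_H1_local_almost_regular`). [cite: CheskidovShvydkoy2010, Thm. 2.4 (case s = 1)] -/
theorem isH1RegularOn_Ioc_forced_of_tao (h : tao2011_forced_H1_local_almost_regular)
    (hν : 0 < ν) (hfs : IsSmoothOnHalfSpace f) (hfd : HasRapidSpaceTimeDecay f)
    (hLH : IsLerayHopfOn T ν f u₀ u)
    (hhyp : ∀ α β : ℝ, 0 ≤ α → α < β → β ≤ T → IsH1RegularOn (Ioo α β) u →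
      limsup (fun t => eH1NormSq (u t)) (𝓝[<] β) < ∞) :
    IsH1RegularOn (Ioc 0 T) u := by
  obtain ⟨c, hc, hloc⟩ := h
  have hfm := clayForce_prod_aestronglyMeasurable (T := T) hfs
  have hf2 := clayForce_prod_eLpNorm_lt_top (T := T) hfs hfd
  -- good times: restart and finite `H¹` norm, a.e. in `(0, T)`
  have hgood : ∀ᵐ s ∂(volume.restrict (Ioo 0 T)),
      IsLerayHopfOn (T - s) ν (fun t => f (t + s)) (u s) (fun t => u (t + s)) ∧
        eH1NormSq (u s) < ∞ := by
    obtain ⟨G, hGm, hG, hGint, -⟩ := hLH.exists_measurable_weakGradient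
    filter_upwards [hLH.ae_isLerayHopfOn_restart_forced hν.le hfm hf2,
      ae_eH1NormSq_lt_top hLH.memLp hGm hG hGint] with s h1 h2
    exact ⟨h1, h2⟩
  have hloc' : ∀ t ∈ Ioc 0 T, ∃ s ∈ Ioo 0 t, IsH1RegularOn (Icc s T) u := by
    intro t ht
    obtain ⟨s, hs, hRs, hfs'⟩ := exists_mem_Ioo_of_ae_restrict_Ioo le_rfl ht.1 ht.2 hgood
    exact ⟨s, hs, isH1RegularOn_Icc_of_good_time_forced hc hloc hν hfs hfd hLH hhyp
      ⟨hs.1, hs.2.trans_le ht.2⟩ hRs hfs'⟩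
  refine ⟨fun t ht => ?_, fun t ht => ?_⟩
  · obtain ⟨s, hs, hreg⟩ := hloc' t ht
    exact hreg.1 t ⟨hs.2.le, ht.2⟩
  · obtain ⟨s, hs, hreg⟩ := hloc' t ht
    refine (hreg.2 t ⟨hs.2.le, ht.2⟩).mono_of_mem_nhdsWithin
      (mem_nhdsWithin.2 ⟨Ioi s, isOpen_Ioi, hs.2, ?_⟩)
    rintro x ⟨hxs, hx⟩
    exact ⟨le_of_lt hxs, hx.2⟩

end Forced

end Literature.Analysis.FluidPDE

end
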